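import Summits.HodgeConjecture.HodgeConjecture.Theorems.P4StubT2cCohClassMapOfHol
import HarnessLib

/-!
# FLOOR-0 B4 archimedean desk (P2a ∕ P4a) — the cohomology class map on `cohForms` extending a class map on the holomorphic cotangent forms:
# the DECOMPOSITION IDENTITY exported, and the two registered stubs it closes — P4a `StubM3CohClassMapWithFormulas` and P2a `StubB4CohIsoOfParts`

Cell hodgecm-mathlib (D-0151), FLOOR 0, crux item H413 = stmt-HodgeConjecture-24833; the F0P2a B4 desk (director s364: the P4a residual line is merged
into it; ONE hand closes both).  PROOF lane (theorems only); author A-p12 (g12).  Per the cell's stub-closer protocol (director s347) no `Lines/` module is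
imported: the two heads' TYPES are the bodies of `…Cruxes.H413.F0P4aMatsushimaHodge.StubM3CohClassMapWithFormulas` (`Lines/F0_P4aMatsushimaHodge.lean`
ed. 1.0.1 d58144ff :233–:249, its ONE `sorry`) and `…Cruxes.H413.F0P2aHodgeRealisation.StubB4CohIsoOfParts` (`Lines/F0_P2aHodgeRealisation.lean` :288–:306)
BINDER FOR BINDER, so that the folds `stub_M3_cohClassMapWithFormulas := P4aStubM3CohClassMapWithFormulas.stubM3_holds` and
`stub_B4_cohIsoOfParts := P4aStubM3CohClassMapWithFormulas.stubB4_holds` are one-liners (brief: F0P4a-plan PLAN v1 §4 «P4a-M3» + v1.2 §1 (a)).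

Content.  A-p08 (g15)'s ★ `P4StubT2cCohClassMapOfHol.exists_cohClassMap_of_hol` ([BorelWallach2000, VII 2.10, 3.6]) builds the `ℂ`-linear extension
`cls := LinearMap.ofIsCompl (isCompl_holCotForms_map_conjFun 𝔞₀) φ ψ` of an injective equivariant `cls₁₀ : holCotForms 𝔞₀ → H` and of `cB ∘ cls₁₀ ∘ conjFun`
on `conjFun (holCotForms 𝔞₀)` (`φ`, `ψ` = ★ `exists_holPart` ∕ `exists_antiholPart`) and proves it injective and equivariant through a LOCAL identity
`cls (a + conjFun a₂) = cls₁₀ a + cB (cls₁₀ a₂)`.  §1 re-runs that proof ONCE with the identity EXPORTED (`exists_cohClassMap_key`); §2 reads off the two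
defining formulas (the identity at `a₂ = 0` ∕ `a = 0`) and surjectivity when `cls₁₀` is onto `P` and `H = P + cB P` (as in F0P3-p01's ★
`CuspCot.exists_cohClassMap_bijective_of_hol`); §3 states the two registered stubs token for token.  Nothing of A-p08's file is re-proved except
the 40-line assembly (its three lemmas are imported BY NAME).

HC_CM is proved only modulo the 7 printed citations until rung 0 closes; this closes two size-S floor-0 stubs (P4a M3, P2a B4) and nothing else.

## References
* [BorelWallach2000] A. Borel, N. Wallach, 2nd ed., AMS 2000 — VII 2.10, 3.2, 3.6 (harmonic ∕ holomorphic forms and `(𝔤,K)`-cohomology).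
* [VoisinHodgeI2002] C. Voisin, *Hodge Theory and Complex Algebraic Geometry I* — Cor. 6.12, Cor. 7.6; [Borel1997] A. Borel, *Automorphic forms on
  SL₂(ℝ)*, §5.14.
-/

set_option autoImplicit false
set_option linter.dupNamespace false

noncomputable section

namespace Summit.HodgeConjecture.HodgeConjecture.Cruxes.H413.P4aStubM3CohClassMapWithFormulas

open MulAction
open Literature.NumberTheory.Automorphic
open Literature.AlgebraicGeometry.ShimuraVarieties
open Summit.HodgeConjecture.HodgeConjecture.Cruxes.H413.CohFormsCarriers
open Summit.HodgeConjecture.HodgeConjecture.Cruxes.H413.P4StubT1ArchFactor (archFactorOf_isHonest)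
open Summit.HodgeConjecture.HodgeConjecture.Cruxes.H413.P4StubT2cCohClassMapOfHol (exists_holPart exists_antiholPart
  conjFun_mem_holCotForms_of_mem_map)

/-! ## §1 The extension with its decomposition identity exported -/

/-- **The extension and its DECOMPOSITION IDENTITY** (generic `H`, `ρ`, `P`, `cls₁₀`, `cB`; honest factor of record `𝔞₀ = archFactorOf F V`): there is a
`ℂ`-linear `cls : cohForms 𝔞₀ → H`, injective and `ρ`-equivariant, with `cls (a + conjFun a₂) = cls₁₀ a + cB (cls₁₀ a₂)` for all holomorphic `a`, `a₂`
— A-p08's ★ `exists_cohClassMap_of_hol` re-run with its local `key` exported. [cite: BorelWallach2000, VII 2.10 and 3.6] -/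
theorem exists_cohClassMap_key (F : HodgeCM.CMField) {ι₁ : F →+* ℂ} (V : HodgeCM.HermSpace3 F ι₁) (H : Type) [AddCommGroup H] [Module ℂ H]
    (ρ : Representation ℂ ↥(HodgeCM.HermSpace3.adelicFin V) H) (P : Submodule ℂ H)
    (cls₁₀ : ↥(holCotForms (archFactorOf F V)) →ₗ[ℂ] H) (hinj : Function.Injective cls₁₀)
    (hequiv : ∀ (g : ↥(HodgeCM.HermSpace3.adelicFin V)) (f : ↥(holCotForms (archFactorOf F V)))
        (hgf : rightRep F V g (f : _) ∈ holCotForms (archFactorOf F V)),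
        cls₁₀ ⟨rightRep F V g (f : _), hgf⟩ = ρ g (cls₁₀ f))
    (hP : ∀ f : ↥(holCotForms (archFactorOf F V)), cls₁₀ f ∈ P)
    (cB : H →ₛₗ[starRingEnd ℂ] H) (hcB : Function.Injective cB)
    (hcBρ : ∀ (g : ↥(HodgeCM.HermSpace3.adelicFin V)) (x : H), cB (ρ g x) = ρ g (cB x))
    (hdisj : ∀ x y : H, x ∈ P → y ∈ P → cB y = x → x = 0) :
    ∃ cls : ↥(cohForms (archFactorOf F V)) →ₗ[ℂ] H,
      Function.Injective cls ∧
      (∀ (g : ↥(HodgeCM.HermSpace3.adelicFin V)) (f : ↥(cohForms (archFactorOf F V)))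
        (hgf : rightRep F V g (f : _) ∈ cohForms (archFactorOf F V)),
        cls ⟨rightRep F V g (f : _), hgf⟩ = ρ g (cls f)) ∧
      ∀ (a : (adelicDatum F V).Adelic → (Fin 2 → ℂ)) (ha : a ∈ holCotForms (archFactorOf F V))
        (a₂ : (adelicDatum F V).Adelic → (Fin 2 → ℂ)) (ha₂ : a₂ ∈ holCotForms (archFactorOf F V))
        (h : a + conjFun F V a₂ ∈ cohForms (archFactorOf F V)),
        cls ⟨a + conjFun F V a₂, h⟩ = cls₁₀ ⟨a, ha⟩ + cB (cls₁₀ ⟨a₂, ha₂⟩) := by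
  have h𝔞 : (archFactorOf F V).IsHonest := archFactorOf_isHonest F V
  have hc := isCompl_holCotForms_map_conjFun (archFactorOf F V)
  obtain ⟨φ, hφ⟩ := exists_holPart (archFactorOf F V) cls₁₀
  obtain ⟨ψ, hψ⟩ := exists_antiholPart (archFactorOf F V) cls₁₀ cB
  -- the decomposition of a cohomological form and the value of the glued map on it (verbatim from A-p08's ★ proof)
  have key : ∀ (a : (adelicDatum F V).Adelic → (Fin 2 → ℂ)) (ha : a ∈ holCotForms (archFactorOf F V))
      (a₂ : (adelicDatum F V).Adelic → (Fin 2 → ℂ)) (ha₂ : a₂ ∈ holCotForms (archFactorOf F V))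
      (h : a + conjFun F V a₂ ∈ cohForms (archFactorOf F V)),
      LinearMap.ofIsCompl hc φ ψ ⟨a + conjFun F V a₂, h⟩ = cls₁₀ ⟨a, ha⟩ + cB (cls₁₀ ⟨a₂, ha₂⟩) := by
    intro a ha a₂ ha₂ h
    have ha' : a ∈ cohForms (archFactorOf F V) := holCotForms_le_cohForms (archFactorOf F V) ha
    have hb' : conjFun F V a₂ ∈ cohForms (archFactorOf F V) := conjFun_mem_cohForms_of_mem_holCotForms ha₂
    have hu : (⟨a, ha'⟩ : ↥(cohForms (archFactorOf F V))) ∈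
        (holCotForms (archFactorOf F V)).comap (cohForms (archFactorOf F V)).subtype := ha
    have hv : (⟨conjFun F V a₂, hb'⟩ : ↥(cohForms (archFactorOf F V))) ∈
        ((holCotForms (archFactorOf F V)).map (conjFun F V)).comap (cohForms (archFactorOf F V)).subtype :=
      Submodule.mem_map_of_mem ha₂
    have hsplit : (⟨a + conjFun F V a₂, h⟩ : ↥(cohForms (archFactorOf F V))) =
        ((⟨⟨a, ha'⟩, hu⟩ : ↥((holCotForms (archFactorOf F V)).comap (cohForms (archFactorOf F V)).subtype)) :
            ↥(cohForms (archFactorOf F V))) +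
          ((⟨⟨conjFun F V a₂, hb'⟩, hv⟩ :
              ↥(((holCotForms (archFactorOf F V)).map (conjFun F V)).comap (cohForms (archFactorOf F V)).subtype)) :
            ↥(cohForms (archFactorOf F V))) :=
      Subtype.ext rfl
    rw [hsplit, map_add, LinearMap.ofIsCompl_apply_left, LinearMap.ofIsCompl_apply_right, hφ, hψ]
    have hcc : (⟨conjFun F V (conjFun F V a₂), conjFun_mem_holCotForms_of_mem_map hv⟩ : ↥(holCotForms (archFactorOf F V))) =
        ⟨a₂, ha₂⟩ := Subtype.ext (conjFun_conjFun F V a₂)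
    exact congrArg (fun z => cls₁₀ ⟨a, ha⟩ + cB (cls₁₀ z)) hcc
  refine ⟨LinearMap.ofIsCompl hc φ ψ, ?_, ?_, key⟩
  · -- injectivity (verbatim from A-p08's ★ proof)
    rw [← LinearMap.ker_eq_bot, Submodule.eq_bot_iff]
    rintro ⟨f, hf⟩ hf0
    rw [LinearMap.mem_ker] at hf0
    obtain ⟨a, ha, b, hb, hab⟩ := Submodule.mem_sup.1 hf
    obtain ⟨a₂, ha₂, rfl⟩ := Submodule.mem_map.1 hb
    have h : (⟨f, hf⟩ : ↥(cohForms (archFactorOf F V))) = ⟨a + conjFun F V a₂, hab.symm ▸ hf⟩ := Subtype.ext hab.symm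
    rw [h, key a ha a₂ ha₂] at hf0
    have h1 : cB (cls₁₀ ⟨-a₂, Submodule.neg_mem _ ha₂⟩) = cls₁₀ ⟨a, ha⟩ := by
      have hneg : (⟨-a₂, Submodule.neg_mem _ ha₂⟩ : ↥(holCotForms (archFactorOf F V))) = -⟨a₂, ha₂⟩ := rfl
      rw [hneg, map_neg, map_neg, eq_comm, eq_neg_iff_add_eq_zero]
      exact hf0
    have h2 : cls₁₀ ⟨a, ha⟩ = 0 := hdisj _ _ (hP _) (hP _) h1
    have ha0 : a = 0 := by
      have := hinj (h2.trans (map_zero cls₁₀).symm)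
      exact congrArg Subtype.val this
    have h3 : cB (cls₁₀ ⟨a₂, ha₂⟩) = 0 := by
      rw [h2, zero_add] at hf0
      exact hf0
    have ha₂0 : a₂ = 0 := by
      have h4 : cls₁₀ ⟨a₂, ha₂⟩ = 0 := hcB (h3.trans (map_zero cB).symm)
      exact congrArg Subtype.val (hinj (h4.trans (map_zero cls₁₀).symm))
    apply Subtype.ext
    show f = 0
    rw [← hab, ha0, ha₂0, map_zero, add_zero]
  · -- equivariance (verbatim from A-p08's ★ proof)
    rintro g ⟨f, hf⟩ hgf
    obtain ⟨a, ha, b, hb, hab⟩ := Submodule.mem_sup.1 hf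
    obtain ⟨a₂, ha₂, rfl⟩ := Submodule.mem_map.1 hb
    have hga : rightRep F V g a ∈ holCotForms (archFactorOf F V) := h𝔞.rightRep_mem_holCotForms ha g
    have hga₂ : rightRep F V g a₂ ∈ holCotForms (archFactorOf F V) := h𝔞.rightRep_mem_holCotForms ha₂ g
    have hsum : rightRep F V g f = rightRep F V g a + conjFun F V (rightRep F V g a₂) := by
      rw [← hab, map_add, conjFun_rightRep]
    have h : (⟨f, hf⟩ : ↥(cohForms (archFactorOf F V))) = ⟨a + conjFun F V a₂, hab.symm ▸ hf⟩ := Subtype.ext hab.symm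
    have h' : (⟨rightRep F V g f, hgf⟩ : ↥(cohForms (archFactorOf F V))) =
        ⟨rightRep F V g a + conjFun F V (rightRep F V g a₂), hsum ▸ hgf⟩ := Subtype.ext hsum
    rw [h', key _ hga _ hga₂, h, key a ha a₂ ha₂, map_add, hequiv g ⟨a, ha⟩ hga, hequiv g ⟨a₂, ha₂⟩ hga₂, hcBρ]

/-! ## §2 Read-offs of the identity: the two defining formulas; surjectivity when `cls₁₀` is onto `P` and `H = P + cB P` -/

section Readoffs

variable {F : HodgeCM.CMField} {ι₁ : F →+* ℂ} {V : HodgeCM.HermSpace3 F ι₁} {H : Type} [AddCommGroup H] [Module ℂ H]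
  {cls₁₀ : ↥(holCotForms (archFactorOf F V)) →ₗ[ℂ] H} {cB : H →ₛₗ[starRingEnd ℂ] H}
  {cls : ↥(cohForms (archFactorOf F V)) →ₗ[ℂ] H}
  (hkey : ∀ (a : (adelicDatum F V).Adelic → (Fin 2 → ℂ)) (ha : a ∈ holCotForms (archFactorOf F V))
    (a₂ : (adelicDatum F V).Adelic → (Fin 2 → ℂ)) (ha₂ : a₂ ∈ holCotForms (archFactorOf F V))
    (h : a + conjFun F V a₂ ∈ cohForms (archFactorOf F V)),
    cls ⟨a + conjFun F V a₂, h⟩ = cls₁₀ ⟨a, ha⟩ + cB (cls₁₀ ⟨a₂, ha₂⟩))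
include hkey

/-- Formula 1: `cls f = cls₁₀ f` for holomorphic `f` (the identity at `a₂ = 0`). [cite: BorelWallach2000, VII 2.10 and 3.6] -/
theorem apply_hol_eq_of_key (f : ↥(holCotForms (archFactorOf F V)))
    (hf : (f : (adelicDatum F V).Adelic → (Fin 2 → ℂ)) ∈ cohForms (archFactorOf F V)) :
    cls ⟨(f : (adelicDatum F V).Adelic → (Fin 2 → ℂ)), hf⟩ = cls₁₀ f := by
  obtain ⟨f, hf'⟩ := f
  have h0 : (0 : (adelicDatum F V).Adelic → (Fin 2 → ℂ)) ∈ holCotForms (archFactorOf F V) := Submodule.zero_mem _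
  have hsum : f + conjFun F V 0 ∈ cohForms (archFactorOf F V) := by rw [map_zero, add_zero]; exact hf
  have h : (⟨f, hf⟩ : ↥(cohForms (archFactorOf F V))) = ⟨f + conjFun F V 0, hsum⟩ :=
    Subtype.ext (show f = f + conjFun F V 0 by rw [map_zero, add_zero])
  rw [h, hkey f hf' 0 h0]
  have hz : (⟨0, h0⟩ : ↥(holCotForms (archFactorOf F V))) = 0 := rfl
  rw [hz, map_zero, map_zero, add_zero]

/-- Formula 2: `cls (conjFun f) = cB (cls₁₀ f)` (the identity at `a = 0`). [cite: BorelWallach2000, VII 2.10 and 3.6] -/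
theorem apply_conjFun_eq_of_key (f : ↥(holCotForms (archFactorOf F V)))
    (hf : conjFun F V (f : (adelicDatum F V).Adelic → (Fin 2 → ℂ)) ∈ cohForms (archFactorOf F V)) :
    cls ⟨conjFun F V (f : (adelicDatum F V).Adelic → (Fin 2 → ℂ)), hf⟩ = cB (cls₁₀ f) := by
  obtain ⟨f, hf'⟩ := f
  have h0 : (0 : (adelicDatum F V).Adelic → (Fin 2 → ℂ)) ∈ holCotForms (archFactorOf F V) := Submodule.zero_mem _
  have hsum : 0 + conjFun F V f ∈ cohForms (archFactorOf F V) := by rw [zero_add]; exact hf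
  have h : (⟨conjFun F V f, hf⟩ : ↥(cohForms (archFactorOf F V))) = ⟨0 + conjFun F V f, hsum⟩ :=
    Subtype.ext (show conjFun F V f = 0 + conjFun F V f by rw [zero_add])
  rw [h, hkey 0 h0 f hf']
  have hz : (⟨0, h0⟩ : ↥(holCotForms (archFactorOf F V))) = 0 := rfl
  rw [hz, map_zero, zero_add]

/-- Surjectivity when `cls₁₀` is onto `P` and every `x ∈ H` is `p + cB q` with `p, q ∈ P` (as in ★ `CuspCot.exists_cohClassMap_bijective_of_hol`).
[cite: BorelWallach2000, VII 2.10 and 3.6] -/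
theorem surjective_of_key {P : Submodule ℂ H} (hPsurj : ∀ x ∈ P, ∃ f : ↥(holCotForms (archFactorOf F V)), cls₁₀ f = x)
    (hsum : ∀ x : H, ∃ p ∈ P, ∃ q ∈ P, x = p + cB q) : Function.Surjective cls := by
  intro x
  obtain ⟨p, hp, q, hq, rfl⟩ := hsum x
  obtain ⟨⟨a, ha⟩, rfl⟩ := hPsurj p hp
  obtain ⟨⟨a₂, ha₂⟩, rfl⟩ := hPsurj q hq
  exact ⟨⟨a + conjFun F V a₂, Submodule.add_mem _ (holCotForms_le_cohForms (archFactorOf F V) ha)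
    (conjFun_mem_cohForms_of_mem_holCotForms ha₂)⟩, hkey a ha a₂ ha₂ _⟩

end Readoffs

/-! ## §3 The two registered stubs, binder for binder -/

/-- **P4a stub M3 `StubM3CohClassMapWithFormulas`, closed by its text** (the body of `…Cruxes.H413.F0P4aMatsushimaHodge.StubM3CohClassMapWithFormulas`,
token for token, so that `stub_M3_cohClassMapWithFormulas := P4aStubM3CohClassMapWithFormulas.stubM3_holds`). [cite: BorelWallach2000, VII 2.10 and 3.6] -/
theorem stubM3_holds :
    ∀ (F : HodgeCM.CMField) {ι₁ : F →+* ℂ} (V : HodgeCM.HermSpace3 F ι₁) (H : Type) [AddCommGroup H] [Module ℂ H]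
      (ρ : Representation ℂ ↥(HodgeCM.HermSpace3.adelicFin V) H) (P : Submodule ℂ H)
      (cls₁₀ : ↥(holCotForms (archFactorOf F V)) →ₗ[ℂ] H), Function.Injective cls₁₀ →
      (∀ (g : ↥(HodgeCM.HermSpace3.adelicFin V)) (f : ↥(holCotForms (archFactorOf F V))) (hgf : rightRep F V g (f : _) ∈ holCotForms (archFactorOf F V)),
          cls₁₀ ⟨rightRep F V g (f : _), hgf⟩ = ρ g (cls₁₀ f)) →
      (∀ f : ↥(holCotForms (archFactorOf F V)), cls₁₀ f ∈ P) →
      ∀ (cB : H →ₛₗ[starRingEnd ℂ] H), Function.Injective cB →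
      (∀ (g : ↥(HodgeCM.HermSpace3.adelicFin V)) (x : H), cB (ρ g x) = ρ g (cB x)) →
      (∀ x y : H, x ∈ P → y ∈ P → cB y = x → x = 0) →
        ∃ cls : ↥(cohForms (archFactorOf F V)) →ₗ[ℂ] H,
          Function.Injective cls ∧
          (∀ f : ↥(holCotForms (archFactorOf F V)), cls ⟨(f : _), holCotForms_le_cohForms (archFactorOf F V) f.2⟩ = cls₁₀ f) ∧
          (∀ f : ↥(holCotForms (archFactorOf F V)),
              cls ⟨conjFun F V (f : _), conjFun_mem_cohForms_of_mem_holCotForms f.2⟩ = cB (cls₁₀ f)) ∧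
          ∀ (g : ↥(HodgeCM.HermSpace3.adelicFin V)) (f : ↥(cohForms (archFactorOf F V))) (hgf : rightRep F V g (f : _) ∈ cohForms (archFactorOf F V)),
            cls ⟨rightRep F V g (f : _), hgf⟩ = ρ g (cls f) := by
  intro F _ V H _ _ ρ P cls₁₀ hinj hequiv hP cB hcB hcBρ hdisj
  obtain ⟨cls, hinj', hequiv', hkey⟩ := exists_cohClassMap_key F V H ρ P cls₁₀ hinj hequiv hP cB hcB hcBρ hdisj
  exact ⟨cls, hinj', fun f => apply_hol_eq_of_key hkey f (holCotForms_le_cohForms (archFactorOf F V) f.2),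
    fun f => apply_conjFun_eq_of_key hkey f (conjFun_mem_cohForms_of_mem_holCotForms f.2), hequiv'⟩

/-- **P2a stub B4 `StubB4CohIsoOfParts`, closed by its text** (the body of `…Cruxes.H413.F0P2aHodgeRealisation.StubB4CohIsoOfParts`, token for token, so that
`stub_B4_cohIsoOfParts := P4aStubM3CohClassMapWithFormulas.stubB4_holds`): with `range cls₁₀ = P`, `cT` involutive commuting with `ρ`, `P ∩ cT P = 0` and
`H = P + cT P`, the extension is a BIJECTION, equivariant, and restricts to `cls₁₀` on the holomorphic forms. [cite: BorelWallach2000, VII 2.10 and 3.6]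
[cite: Borel1997, §5.14] [cite: VoisinHodgeI2002, Cor. 7.6] -/
theorem stubB4_holds :
    ∀ (F : HodgeCM.CMField) {ι₁ : F →+* ℂ} (V : HodgeCM.HermSpace3 F ι₁) (H : Type) [AddCommGroup H] [Module ℂ H]
        (ρ : Representation ℂ ↥(HodgeCM.HermSpace3.adelicFin V) H) (P : Submodule ℂ H)
        (cls₁₀ : ↥(holCotForms (archFactorOf F V)) →ₗ[ℂ] H),
        Function.Injective cls₁₀ →
          (∀ (g : ↥(HodgeCM.HermSpace3.adelicFin V)) (f : ↥(holCotForms (archFactorOf F V)))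
              (hgf : rightRep F V g (f : _) ∈ holCotForms (archFactorOf F V)),
              cls₁₀ ⟨rightRep F V g (f : _), hgf⟩ = ρ g (cls₁₀ f)) →
            LinearMap.range cls₁₀ = P →
              ∀ cT : H →ₛₗ[starRingEnd ℂ] H, (∀ x : H, cT (cT x) = x) →
                (∀ (g : ↥(HodgeCM.HermSpace3.adelicFin V)) (x : H), cT (ρ g x) = ρ g (cT x)) →
                  (∀ x y : H, x ∈ P → y ∈ P → cT y = x → x = 0) →
                    (∀ z : H, ∃ x ∈ P, ∃ y ∈ P, z = x + cT y) →
                      ∃ cls : ↥(cohForms (archFactorOf F V)) →ₗ[ℂ] H,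
                        Function.Bijective cls ∧
                          (∀ (g : ↥(HodgeCM.HermSpace3.adelicFin V)) (f : ↥(cohForms (archFactorOf F V)))
                              (hgf : rightRep F V g (f : _) ∈ cohForms (archFactorOf F V)),
                              cls ⟨rightRep F V g (f : _), hgf⟩ = ρ g (cls f)) ∧
                          ∀ f : ↥(holCotForms (archFactorOf F V)), cls ⟨(f : _), Submodule.mem_sup_left f.2⟩ = cls₁₀ f := by
  intro F _ V H _ _ ρ P cls₁₀ hinj hequiv hrange cT hcT hcTρ hdisj hsum
  have hP : ∀ f : ↥(holCotForms (archFactorOf F V)), cls₁₀ f ∈ P := fun f => hrange ▸ LinearMap.mem_range_self cls₁₀ f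
  have hPsurj : ∀ x ∈ P, ∃ f : ↥(holCotForms (archFactorOf F V)), cls₁₀ f = x := fun x hx =>
    LinearMap.mem_range.1 (hrange.symm ▸ hx)
  have hcTinj : Function.Injective cT := Function.LeftInverse.injective hcT
  obtain ⟨cls, hinj', hequiv', hkey⟩ := exists_cohClassMap_key F V H ρ P cls₁₀ hinj hequiv hP cT hcTinj hcTρ hdisj
  exact ⟨cls, ⟨hinj', surjective_of_key hkey hPsurj hsum⟩, hequiv', fun f => apply_hol_eq_of_key hkey f (Submodule.mem_sup_left f.2)⟩

end Summit.HodgeConjecture.HodgeConjecture.Cruxes.H413.P4aStubM3CohClassMapWithFormulas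

end
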